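import Literature.NumberTheory.ModularForms.PoincareSeriesWeightTwoHeckeUnfolding
import HarnessLib

/-!
# Unfolding the Hecke-regularised weight-2 Poincaré series against an arbitrary weight-2
# automorphic function (proofs only)

Topic `Literature/NumberTheory/ModularForms` (namespace `Literature.NumberTheory.ModularForms.PoincareWeightTwo`).
THEOREMS ONLY. The unfolding of `PoincareSeriesWeightTwoHeckeUnfolding.lean` (stub U of the fact
skeleton I1 `poincare-hecke`, crux item stmt-Parity-20404) with the cusp form `f` replaced by an
ARBITRARY measurable function `G : ℍ → ℂ` with the weight-2 law `G(γz) = (cz+d)² G(z)` for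
`γ ∈ Γ₀(N)` (e.g. `G = y^{s'} P_m(·,s')` by T1, or Hecke's limit `Q_m`): Iwaniec–Kowalski's unfolding
(proof of Lemma 14.3) only uses that law. This is the entry point of the `L²` treatment of Hecke's
limit (the Gram pairings `⟨yˢP_m(·,s), y^{s'}P_m(·,s')⟩`, stub T4 of the skeleton):

* `peterssonPairing_rpow_mul_poincareHecke_eq_setIntegral` — for every real `s`,
  `⟨yˢ P_m(·,s), G⟩ = ∫_{0 ≤ Re < 1} conj(e(mw)) (Im w)^{s+2} G(w) dμ(w)` as soon as the right-hand
  integrand is integrable on the strip;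
* `setIntegral_strip_seed_eq_integral_modes` — the strip integral in coordinates:
  `= ∫_{y>0} y^s e^{−2πmy} (∫₀¹ G(x+iy) e(−mx) dx) dy`, i.e. the `m`-th Fourier mode of `G` on the
  horocycle `Im = y` against `y^s e^{−2πmy} dy`.

Cell `landau-siegel` / `ls-inputs` (D-0154 (2)), seat `ls-inputs-I1-w2`. «The programme SEARCHES and
TYPES; no claim about Landau–Siegel zeros, Theorems 1–2 of arXiv:2211.02515 or a repaired Margin232
until a kernel theorem says so.»

## References

* [IwaniecKowalski2004] H. Iwaniec, E. Kowalski, *Analytic Number Theory*, Lemma 14.3 (proof: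
  unfolding), §14.1 (14.4), §3.2 (Hecke's trick).
* [Iwaniec2002] H. Iwaniec, *Spectral Methods of Automorphic Forms*, §3.2 (3.13).
* [Freitag1990] E. Freitag, *Hilbert Modular Forms*, Ch. II §1 Remark 1.1 (`dω = dx dy/y²`).
-/

noncomputable section

open scoped MatrixGroups Real ModularForm ComplexConjugate NNReal ENNReal
open CongruenceSubgroup Complex MeasureTheory Set Filter
open UpperHalfPlane hiding I
open Literature.NumberTheory.EllipticCurves.ModularForms

namespace Literature.NumberTheory.ModularForms.PoincareWeightTwo

variable {N : ℕ}

/-! ### The weight-2 law along rows and translations -/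

/-- The weight-2 law for `Γ₀(N)` along a row: `G(γ_v w) = j_v(w)² G(w)`. [cite: IwaniecKowalski2004, §14.1 (14.1)] -/
theorem weightTwoLaw_rowMatrix [NeZero N] {G : ℍ → ℂ}
    (hG : ∀ γ : SL(2, ℤ), γ ∈ Gamma0 N → ∀ z : ℍ,
      G (γ • z) = (rowDenom ((γ : Matrix (Fin 2) (Fin 2) ℤ) 1) z) ^ 2 * G z)
    (v : Row N) (w : ℍ) :
    G (rowMatrix v.1 v.2.1 • w) = rowDenom v.1 w ^ 2 * G w := by
  rw [hG _ (rowMatrix_mem_Gamma0 v) w, rowDenom_apply_one_eq_denom, denom_rowMatrix]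

/-- The weight-2 law for `Γ₀(N)` under translations: `G(Tⁿ w) = G(w)`. [cite: IwaniecKowalski2004, §14.1 (14.1)] -/
theorem weightTwoLaw_T_zpow [NeZero N] {G : ℍ → ℂ}
    (hG : ∀ γ : SL(2, ℤ), γ ∈ Gamma0 N → ∀ z : ℍ,
      G (γ • z) = (rowDenom ((γ : Matrix (Fin 2) (Fin 2) ℤ) 1) z) ^ 2 * G z)
    (n : ℤ) (w : ℍ) :
    G (ModularGroup.T ^ n • w) = G w := by
  rw [hG _ (T_zpow_mem_Gamma0 N n) w, rowDenom_apply_one_eq_denom, ModularGroup.denom_apply,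
    ModularGroup.coe_T_zpow]
  simp

/-! ### Pointwise identities with a general weight-2 automorphic `G` -/

/-- **One term, conjugated, against `y^{s+2} G`, is the seed at `γ_v w`** for any `G` with the weight-2
law along the row: `conj(poincareTerm_v(w)) (Im w)^{s+2} G(w) = conj(e(mγ_v w)) (Im γ_v w)^{s+2} G(γ_v w)`.
[cite: IwaniecKowalski2004, Lemma 14.3 (proof)] -/
theorem conj_poincareTerm_mul_eq_seed_smul_of_law (m : ℕ) (s : ℝ) {G : ℍ → ℂ} (v : Row N)
    (hGv : ∀ w : ℍ, G (rowMatrix v.1 v.2.1 • w) = rowDenom v.1 w ^ 2 * G w) (w : ℍ) :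
    conj (poincareTerm N m s v w) * ((w.im ^ (s + 2) : ℝ) : ℂ) * G w =
      conj (cexp (2 * π * I * m * ((rowMatrix v.1 v.2.1 • w : ℍ) : ℂ))) *
        (((rowMatrix v.1 v.2.1 • w).im ^ (s + 2) : ℝ) : ℂ) * G (rowMatrix v.1 v.2.1 • w) := by
  set j : ℂ := rowDenom v.1 w with hjdef
  have hj : j ≠ 0 := rowDenom_ne_zero v.1 v.2.1 w
  have hJ : 0 < ‖j‖ := norm_pos_iff.mpr hj
  have hy : 0 < w.im := w.im_pos
  rw [im_rowMatrix_smul, hGv, ← hjdef]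
  unfold poincareTerm
  rw [← hjdef, map_mul, map_mul, map_inv₀, map_pow, Complex.conj_ofReal]
  have hJ2 : 0 < ‖j‖ ^ 2 := by positivity
  have hA : ‖j‖ ^ (-(2 * s)) = ((‖j‖ ^ 2) ^ s)⁻¹ := by
    rw [Real.rpow_neg hJ.le, Real.rpow_mul hJ.le, Real.rpow_two]
  have hB : (w.im / ‖j‖ ^ 2) ^ (s + 2) = w.im ^ (s + 2) / ((‖j‖ ^ 2) ^ s * (‖j‖ ^ 2) ^ 2) := by
    rw [Real.div_rpow hy.le hJ2.le, Real.rpow_add hJ2, Real.rpow_two]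
  rw [hA, hB]
  have hAS : ((‖j‖ ^ 2) ^ s : ℝ) ≠ 0 := (Real.rpow_pos_of_pos hJ2 s).ne'
  have hconj : conj j = ((‖j‖ ^ 2 : ℝ) : ℂ) / j := by
    rw [eq_div_iff hj, Complex.conj_mul']; push_cast; ring
  have hcj : conj j ≠ 0 := by rw [hconj]; exact div_ne_zero (by exact_mod_cast hJ2.ne') hj
  rw [hconj]
  push_cast
  field_simp

/-- **The Petersson integrand of `yˢ P_m(·,s)` against `G` is half the row sum of the seed** (any `G`
with the weight-2 law along the rows). [cite: IwaniecKowalski2004, Lemma 14.3 (proof)] -/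
theorem petersson_rpow_mul_poincareHecke_eq_tsum_of_law (m : ℕ) (s : ℝ) {G : ℍ → ℂ}
    (hGv : ∀ (v : Row N) (w : ℍ), G (rowMatrix v.1 v.2.1 • w) = rowDenom v.1 w ^ 2 * G w) (w : ℍ) :
    petersson 2 (fun z : ℍ ↦ ((z.im ^ s : ℝ) : ℂ) * poincareHecke N m s z) G w =
      (1 / 2 : ℂ) * ∑' v : Row N, conj (cexp (2 * π * I * m * ((rowMatrix v.1 v.2.1 • w : ℍ) : ℂ))) *
        (((rowMatrix v.1 v.2.1 • w).im ^ (s + 2) : ℝ) : ℂ) * G (rowMatrix v.1 v.2.1 • w) := by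
  simp_rw [← conj_poincareTerm_mul_eq_seed_smul_of_law m s _ (hGv _)]
  unfold petersson poincareHecke
  rw [map_mul, Complex.conj_ofReal, map_mul, Complex.conj_tsum, tsum_mul_right, tsum_mul_right]
  have h12 : conj (1 / 2 : ℂ) = 1 / 2 := by rw [map_div₀, map_one, map_ofNat]
  rw [h12]
  have hy : 0 < w.im := w.im_pos
  have hpow : ((w.im ^ (s + 2) : ℝ) : ℂ) = ((w.im ^ s : ℝ) : ℂ) * (w.im : ℂ) ^ (2 : ℕ) := by
    rw [Real.rpow_add hy, Real.rpow_two]; push_cast; ring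
  rw [hpow]
  simp only [zpow_ofNat]
  ring

/-! ### The unfolding -/

/-- **Unfolding `yˢ P_m(·, s)` against a weight-2 automorphic `G`** (Iwaniec–Kowalski, proof of Lemma
14.3, at `k = 2` with Hecke's factor; the law `G(γz) = (cz+d)² G(z)`, `γ ∈ Γ₀(N)`, is all that is used
about `G`): for every real `s` and measurable `G` whose seed `conj(e(mw)) (Im w)^{s+2} G(w)` is
integrable on the strip, `⟨yˢP_m(·,s), G⟩ = ∫_{0 ≤ Re < 1} conj(e(mw)) (Im w)^{s+2} G(w) dμ(w)`.
[cite: IwaniecKowalski2004, Lemma 14.3 (proof: unfolding)] -/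
theorem peterssonPairing_rpow_mul_poincareHecke_eq_setIntegral [NeZero N] (m : ℕ) (s : ℝ) {G : ℍ → ℂ}
    (hGm : Measurable G)
    (hG : ∀ γ : SL(2, ℤ), γ ∈ Gamma0 N → ∀ z : ℍ,
      G (γ • z) = (rowDenom ((γ : Matrix (Fin 2) (Fin 2) ℤ) 1) z) ^ 2 * G z)
    (hint : IntegrableOn
      (fun w : ℍ ↦ conj (cexp (2 * π * I * m * (w : ℂ))) * ((w.im ^ (s + 2) : ℝ) : ℂ) * G w)
      {w : ℍ | 0 ≤ w.re ∧ w.re < 1} volume) :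
    peterssonPairing N 2 (fun z : ℍ ↦ ((z.im ^ s : ℝ) : ℂ) * poincareHecke N m s z) G =
      ∫ w in {w : ℍ | 0 ≤ w.re ∧ w.re < 1},
        conj (cexp (2 * π * I * m * (w : ℂ))) * ((w.im ^ (s + 2) : ℝ) : ℂ) * G w := by
  letI : Fintype (↥𝒮ℒ ⧸ (Gamma0 N : Subgroup (GL (Fin 2) ℝ)).subgroupOf 𝒮ℒ) := Fintype.ofFinite _
  obtain ⟨g, hg⟩ := exists_mapGL_eq_out (N := N)
  set h : ℍ → ℂ := fun w ↦
    conj (cexp (2 * π * I * m * (w : ℂ))) * ((w.im ^ (s + 2) : ℝ) : ℂ) * G w with hhdef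
  set P : Set ℍ := {u : ℍ | 0 ≤ u.re ∧ u.re < 1} with hPdef
  have hP : MeasurableSet P :=
    (measurableSet_le measurable_const UpperHalfPlane.continuous_re.measurable).inter
      (measurableSet_lt UpperHalfPlane.continuous_re.measurable measurable_const)
  set v : ℍ → ℂ := P.indicator h with hvdef
  have hT : ∀ (n : ℤ) (w : ℍ), h (ModularGroup.T ^ n • w) = h w := by
    intro n w
    simp only [hhdef]
    rw [weightTwoLaw_T_zpow hG, UpperHalfPlane.modular_T_zpow_smul, UpperHalfPlane.vadd_im,
      UpperHalfPlane.coe_vadd]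
    congr 2
    rw [mul_add, Complex.exp_add]
    have hper : cexp (2 * π * I * m * ((n : ℝ) : ℂ)) = 1 := by
      rw [← Complex.exp_int_mul_two_pi_mul_I ((m : ℤ) * n)]
      congr 1; push_cast; ring
    rw [hper, one_mul]
  -- Step 1: the Petersson integrand through the cosets is `½ Σ_q Σ'_δ v(δ g_q⁻¹ τ)`
  have h1 : ∀ τ : ℍ, ∑ q : ↥𝒮ℒ ⧸ (Gamma0 N : Subgroup (GL (Fin 2) ℝ)).subgroupOf 𝒮ℒ,
        petersson 2 (fun z : ℍ ↦ ((z.im ^ s : ℝ) : ℂ) * poincareHecke N m s z) G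
          (((q.out : ↥𝒮ℒ) : GL (Fin 2) ℝ)⁻¹ • τ) =
      (1 / 2 : ℂ) * ∑ q : ↥𝒮ℒ ⧸ (Gamma0 N : Subgroup (GL (Fin 2) ℝ)).subgroupOf 𝒮ℒ,
        ∑' δ : Gamma0 N, v ((δ : SL(2, ℤ)) • (g q)⁻¹ • τ) := by
    intro τ
    rw [Finset.mul_sum]
    refine Finset.sum_congr rfl fun q _ ↦ ?_
    have hsm : ((q.out : ↥𝒮ℒ) : GL (Fin 2) ℝ)⁻¹ • τ = (g q)⁻¹ • τ := by
      rw [← hg q, ← map_inv]; rfl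
    rw [hsm, petersson_rpow_mul_poincareHecke_eq_tsum_of_law m s (weightTwoLaw_rowMatrix hG),
      ← tsum_gamma0_indicator_eq_tsum_rows h hT]
  -- Step 2: integrability and measurability of the cut-off seed
  have hh_meas : Measurable h :=
    ((Complex.continuous_conj.measurable.comp (Complex.measurable_exp.comp
      (measurable_const.mul UpperHalfPlane.continuous_coe.measurable))).mul
      (Complex.measurable_ofReal.comp (UpperHalfPlane.continuous_im.measurable.pow_const _))).mul hGm
  have hv_meas : Measurable v := hh_meas.indicator hP
  have hv_int : Integrable v := hint.integrable_indicator hP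
  -- Step 3: unfold
  unfold peterssonPairing
  rw [setIntegral_congr_fun ModularGroup.isClosed_fd.measurableSet (fun τ _ ↦ h1 τ), integral_const_mul,
    Unfolding.integral_fd_sum_tsum_smul_eq g hg v hv_int hv_meas, hvdef, integral_indicator hP]
  ring

/-! ### The strip integral in coordinates: the `m`-th mode against `yˢ e^{−2πmy} dy` -/

/-- The seed in coordinates at `(x, y)`, `y > 0`: `y⁻² · conj(e(m(x+iy))) y^{s+2} G = y^s e^{−2πmy} · (e(−mx) G)`.
[cite: IwaniecKowalski2004, Lemma 14.3 (proof)] -/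
private theorem invImSq_smul_seed_mk (m : ℕ) (s : ℝ) (G : ℂ → ℂ) (x : ℝ) {y : ℝ} (hy : 0 < y) :
    ((((1 / ‖(⟨x, y⟩ : ℂ).im‖₊) ^ 2 : ℝ≥0) : ℝ)) •
        (conj (cexp (2 * π * I * m * (⟨x, y⟩ : ℂ))) * ((((⟨x, y⟩ : ℂ).im) ^ (s + 2) : ℝ) : ℂ) * G ⟨x, y⟩) =
      (((y ^ s * Real.exp (-(2 * π * m * y))) : ℝ) : ℂ) * (G ⟨x, y⟩ * cexp (-(2 * π * I * m * x))) := by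
  have him : (⟨x, y⟩ : ℂ).im = y := rfl
  have hρ : (((1 / ‖(⟨x, y⟩ : ℂ).im‖₊) ^ 2 : ℝ≥0) : ℝ) = (y ^ 2)⁻¹ := by
    push_cast; rw [Real.norm_of_nonneg hy.le, one_div, inv_pow]
  have hy0 : (y : ℂ) ≠ 0 := by exact_mod_cast hy.ne'
  have hconj : conj (cexp (2 * π * I * m * (⟨x, y⟩ : ℂ))) =
      ((Real.exp (-(2 * π * m * y)) : ℝ) : ℂ) * cexp (-(2 * π * I * m * x)) := by
    rw [← Complex.exp_conj, Complex.ofReal_exp, ← Complex.exp_add]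
    congr 1
    apply Complex.ext <;>
      simp [mul_re, mul_im, Complex.conj_re, Complex.conj_im, Complex.I_re, Complex.I_im]
  rw [hρ, him, hconj, Complex.real_smul, Real.rpow_add hy, Real.rpow_two]
  push_cast
  field_simp

/-- **The strip integral of the seed in coordinates**: for `G : ℂ → ℂ` (read on `ℍ` through the
inclusion) whose seed is integrable on the strip,
`∫_{0 ≤ Re < 1} conj(e(mw)) (Im w)^{s+2} G(w) dμ = ∫_{y>0} y^s e^{−2πmy} (∫₀¹ G(x+iy) e(−mx) dx) dy`.
[cite: IwaniecKowalski2004, Lemma 14.3 (proof)] -/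
theorem setIntegral_strip_seed_eq_integral_modes (m : ℕ) (s : ℝ) (G : ℂ → ℂ)
    (hint : IntegrableOn
      (fun w : ℍ ↦ conj (cexp (2 * π * I * m * (w : ℂ))) * ((w.im ^ (s + 2) : ℝ) : ℂ) * G w)
      {w : ℍ | 0 ≤ w.re ∧ w.re < 1} volume) :
    ∫ w in {w : ℍ | 0 ≤ w.re ∧ w.re < 1},
        conj (cexp (2 * π * I * m * (w : ℂ))) * ((w.im ^ (s + 2) : ℝ) : ℂ) * G w =
      ∫ y in Ioi (0 : ℝ), (((y ^ s * Real.exp (-(2 * π * m * y))) : ℝ) : ℂ) *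
        ∫ x in (0 : ℝ)..1, G ((x : ℂ) + y * I) * cexp (-(2 * π * I * m * x)) := by
  set Gs : ℂ → ℂ := fun z ↦ conj (cexp (2 * π * I * m * z)) * ((z.im ^ (s + 2) : ℝ) : ℂ) * G z with hGs
  have hcoe : (fun w : ℍ ↦ conj (cexp (2 * π * I * m * (w : ℂ))) * ((w.im ^ (s + 2) : ℝ) : ℂ) * G w) =
      fun w : ℍ ↦ Gs w := by
    funext w; simp only [hGs, UpperHalfPlane.coe_im]
  rw [hcoe] at hint ⊢
  obtain ⟨hiff, heq⟩ := setIntegral_strip_eq_prod Gs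
  have hprod := hiff.mp hint
  rw [heq, setIntegral_prod _ hprod]
  refine setIntegral_congr_fun measurableSet_Ioi fun y hy ↦ ?_
  rw [mem_Ioi] at hy
  have e2 : ∀ x : ℝ, ((((1 / ‖(⟨(y, x).2, (y, x).1⟩ : ℂ).im‖₊) ^ 2 : ℝ≥0) : ℝ)) • Gs ⟨(y, x).2, (y, x).1⟩ =
      (((y ^ s * Real.exp (-(2 * π * m * y))) : ℝ) : ℂ) * (G ⟨x, y⟩ * cexp (-(2 * π * I * m * x))) := by
    intro x
    exact invImSq_smul_seed_mk m s G x hy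
  simp_rw [e2]
  rw [integral_const_mul, intervalIntegral.integral_of_le zero_le_one,
    setIntegral_congr_set Ico_ae_eq_Ioc]
  congr 1
  refine setIntegral_congr_fun measurableSet_Ioc fun x _ ↦ ?_
  rw [show ((x : ℂ) + y * I) = (⟨x, y⟩ : ℂ) from (Complex.mk_eq_add_mul_I x y).symm]

end Literature.NumberTheory.ModularForms.PoincareWeightTwo

end
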